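import Summits.Ventures.WeilGRH.EvenCharacterFamilyFlatTest
import Summits.Ventures.WeilGRH.CharacterSubgroupFlatTest
import HarnessLib

/-!
# GRH arm (rh-explicit, venture WeilGRH): one-sided CHEBOTAREV for every class of every abelian field —
  the flat-window family over a subgroup `H` with the coset weights `1 + Re χ(u)`

Cell `rh-explicit`, WEIL TRACK (structure seat weil-3, gen8).  The master inequality
(`EvenCharacterFamilyFlatTest.weightedFamily_flatWindow_le`: any weight `w ≥ 0` on the characters mod `q`)
specialised to

  `w_χ = 𝟙_H(χ)·(1 + Re χ(u))`   (`H ∋ 1` multiplicatively closed, `u` a unit mod `q`),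

whose class function is (`sum_cosetWeight_mul_re_char`)

  `ŵ(n) = |H|·(𝟙[n ∈ H^⊥] + ½𝟙[u·n ∈ H^⊥] + ½𝟙[u⁻¹·n ∈ H^⊥])`,   `H^⊥ = {x : χ(x) = 1 ∀ χ ∈ H}`:

the prime powers whose class in `(ℤ/q)^×/H^⊥ ≅ Gal(K_H/ℚ)` is trivial, `u^{-1}H^⊥` or `uH^⊥` — the Frobenius
classes of the abelian field `K_H` cut out by `H`.  Hence (`coset_flatWindow_le_of_subgroupFamily`,
`coset_flatSum_le_of_subgroupFamily`): if the `ζ` rung and the rungs of every `χ ∈ H ∖ {1}` hold at the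
window `a > 0` and `u ∉ H^⊥`, then

  `Σ_{log n<2a, n ∈ uH^⊥} Λ(n)n^{-1/2}(1 − log n/(2a)) ≤ (1 − 2/|H|) log q + 32 sinh²(a/2)/(|H| a) − 2.23 + 5/a`

— a one-sided Chebotarev density bound at square-root strength for EVERY class of EVERY abelian number
field of conductor dividing `q`, from Weil positivity at ONE window (`H` = all characters:
`CharacterFamilyProgressions`; `u = 1`: `CharacterSubgroupFlatTest`).  No definitions, no named facts,
RH/GRH-free.

## References

* J. C. Lagarias, A. M. Odlyzko, *Effective versions of the Chebotarev density theorem* (1977) (the GRH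
  shape `π_C(x) = (|C|/|G|) Li x + O(√x log(d_L x^n))`). [LagariasOdlyzko1977]
* A. M. Odlyzko, *Bounds for discriminants …: a survey of recent results*, Sém. Théor. Nombres Bordeaux 2
  (1990) 119–141, §2 (2.3)–(2.6), §6 Open Problem 6.3. [Odlyzko1990Bounds]
* A. Weil, *Sur les "formules explicites" de la théorie des nombres premiers* (1952). [Weil1952FormulesExplicites]
-/

set_option autoImplicit false

noncomputable section

open Complex Filter Set MeasureTheory
open scoped Real Topology ComplexConjugate ArithmeticFunction.vonMangoldt

namespace Summit.Ventures.WeilGRH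

open Literature.NumberTheory.LFunctions

variable {q : ℕ} {a : ℝ}

/-! ## The coset weights and their class function -/

/-- **The class function of the coset weights**: for `H` multiplicatively closed, `u` a unit and
`x ∈ ZMod q`,
`Σ_{χ∈H} (1 + Re χ(u))·Re χ(x) = |H|·(𝟙[x ∈ H^⊥] + ½𝟙[u x ∈ H^⊥] + ½𝟙[u⁻¹ x ∈ H^⊥])`
(`H^⊥ = {y : χ(y) = 1 ∀ χ ∈ H}`). -/
theorem sum_cosetWeight_mul_re_char [NeZero q] {s : Finset (DirichletCharacter ℂ q)}
    (hmul : ∀ χ ∈ s, ∀ ψ ∈ s, χ * ψ ∈ s) (u : (ZMod q)ˣ) (x : ZMod q) :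
    ∑ χ ∈ s, (1 + (χ (u : ZMod q)).re) * (χ x).re =
      (s.card : ℝ) * ((if ∀ χ ∈ s, χ x = 1 then 1 else 0) +
        (if ∀ χ ∈ s, χ ((u : ZMod q) * x) = 1 then 1 / 2 else 0) +
        (if ∀ χ ∈ s, χ (((u⁻¹ : (ZMod q)ˣ) : ZMod q) * x) = 1 then 1 / 2 else 0)) := by
  classical
  have hterm : ∀ χ : DirichletCharacter ℂ q, (1 + (χ (u : ZMod q)).re) * (χ x).re =
      (χ x).re + ((χ ((u : ZMod q) * x)).re + (χ (((u⁻¹ : (ZMod q)ˣ) : ZMod q) * x)).re) / 2 := by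
    intro χ
    rw [add_mul, one_mul, re_mul_re_eq_half, conj_char_unit, ← map_mul, ← map_mul]
  simp_rw [hterm]
  rw [Finset.sum_add_distrib, ← Finset.sum_div, Finset.sum_add_distrib, ← Complex.re_sum, ← Complex.re_sum,
    ← Complex.re_sum, re_sum_char_eq_of_mulClosed hmul, re_sum_char_eq_of_mulClosed hmul,
    re_sum_char_eq_of_mulClosed hmul]
  split_ifs <;> ring

/-! ## One-sided Chebotarev for the classes of `K_H` -/

/-- **THE COSET FAMILY INEQUALITY** (`q ≠ 1`, `a > 0`, `H ∋ 1` multiplicatively closed, `u` a unit with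
`u ∉ H^⊥`).  If `WeilPositivityOn a` and `WeilPositivityOnChar χ a` for every `χ ∈ H ∖ {1}`, then

  `2|H|·Σ_{n∈H^⊥} c_n + |H|·Σ_{u n∈H^⊥} c_n + |H|·Σ_{u⁻¹ n∈H^⊥} c_n + Σ_{χ∈H}(1 + Re χ(u))(K_κ − I_κ(a)/a)`
    `≤ (|H| − 2)·log q + 32 sinh²(a/2)/a`

(`c_n = Λ(n)n^{-1/2}(1 − log n/(2a))` over `log n < 2a`): the prime powers in the Frobenius classes `1`,
`u^{-1}H^⊥`, `uH^⊥` of `K_H` carry positive weights, all others drop out.  RH/GRH-free. -/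
theorem coset_flatWindow_le_of_subgroupFamily [NeZero q] (hq : q ≠ 1) (ha : 0 < a)
    {s : Finset (DirichletCharacter ℂ q)} (h1 : (1 : DirichletCharacter ℂ q) ∈ s)
    (hmul : ∀ χ ∈ s, ∀ ψ ∈ s, χ * ψ ∈ s)
    (hζ : WeilPositivityOn a) (hχ : ∀ χ ∈ s, χ ≠ 1 → WeilPositivityOnChar χ a)
    (u : (ZMod q)ˣ) (hu : ¬ ∀ χ ∈ s, χ (u : ZMod q) = 1) :
    2 * (s.card : ℝ) * (∑ n ∈ (weilPrimeIndex a).filter (fun n : ℕ ↦ ∀ χ ∈ s, χ (n : ZMod q) = 1),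
          (Λ n : ℝ) / Real.sqrt n * (1 - Real.log n / (2 * a))) +
        (s.card : ℝ) * (∑ n ∈ (weilPrimeIndex a).filter
            (fun n : ℕ ↦ ∀ χ ∈ s, χ ((u : ZMod q) * (n : ZMod q)) = 1),
          (Λ n : ℝ) / Real.sqrt n * (1 - Real.log n / (2 * a))) +
        (s.card : ℝ) * (∑ n ∈ (weilPrimeIndex a).filter
            (fun n : ℕ ↦ ∀ χ ∈ s, χ (((u⁻¹ : (ZMod q)ˣ) : ZMod q) * (n : ZMod q)) = 1),
          (Λ n : ℝ) / Real.sqrt n * (1 - Real.log n / (2 * a))) +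
        ∑ χ ∈ s, (1 + (χ (u : ZMod q)).re) *
          ((Real.log (4 * π) + Real.eulerMascheroniConstant +
              2 * ∫ t in Ioi (0 : ℝ), weilKillingDensityPar (charParity χ) t) -
            1 / a * ∫ t in Ioi (0 : ℝ), weilArchDensityPar (charParity χ) t * min t (2 * a)) ≤
      ((s.card : ℝ) - 2) * Real.log q + 32 * Real.sinh (a / 2) ^ 2 / a := by
  classical
  set c : ℕ → ℝ := fun n ↦ (Λ n : ℝ) / Real.sqrt n * (1 - Real.log n / (2 * a)) with hc
  set K : DirichletCharacter ℂ q → ℝ := fun χ ↦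
    (Real.log (4 * π) + Real.eulerMascheroniConstant +
        2 * ∫ t in Ioi (0 : ℝ), weilKillingDensityPar (charParity χ) t) -
      1 / a * ∫ t in Ioi (0 : ℝ), weilArchDensityPar (charParity χ) t * min t (2 * a) with hK
  -- the coset weights
  set w : DirichletCharacter ℂ q → ℝ := fun χ ↦ if χ ∈ s then 1 + (χ (u : ZMod q)).re else 0 with hw
  have hw0 : ∀ χ, 0 ≤ w χ := fun χ ↦ by
    simp only [hw]
    split_ifs
    · exact weight_nonneg χ _
    · exact le_rfl
  have hwr : ∀ χ : DirichletCharacter ℂ q, χ ≠ 1 → w χ ≠ 0 → WeilPositivityOnChar χ a := by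
    intro χ hne hwne
    have hmem : χ ∈ s := by
      by_contra h
      exact hwne (by simp only [hw, if_neg h])
    exact hχ χ hmem hne
  have hmaster := weightedFamily_flatWindow_le hq ha hζ w hw0 hwr
  -- `Σ w = |H|`, `w 1 = 2`
  have hsumw : ∑ χ : DirichletCharacter ℂ q, w χ = (s.card : ℝ) := by
    simp only [hw]
    rw [Finset.sum_ite_mem, Finset.univ_inter, Finset.sum_add_distrib, Finset.sum_const, nsmul_eq_mul,
      mul_one, ← Complex.re_sum, re_sum_char_eq_of_mulClosed hmul, if_neg hu, add_zero]
  have hw1 : w 1 = 2 := by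
    simp only [hw, if_pos h1]
    rw [MulChar.one_apply_coe]; norm_num
  -- the class function
  have hclass : ∀ n : ℕ, ∑ χ : DirichletCharacter ℂ q, w χ * (χ (n : ZMod q)).re =
      (s.card : ℝ) * ((if ∀ χ ∈ s, χ (n : ZMod q) = 1 then 1 else 0) +
        (if ∀ χ ∈ s, χ ((u : ZMod q) * (n : ZMod q)) = 1 then 1 / 2 else 0) +
        (if ∀ χ ∈ s, χ (((u⁻¹ : (ZMod q)ˣ) : ZMod q) * (n : ZMod q)) = 1 then 1 / 2 else 0)) := by
    intro n
    have : ∀ χ : DirichletCharacter ℂ q, w χ * (χ (n : ZMod q)).re =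
        if χ ∈ s then (1 + (χ (u : ZMod q)).re) * (χ (n : ZMod q)).re else 0 := fun χ ↦ by
      simp only [hw]; split_ifs <;> ring
    simp_rw [this]
    rw [Finset.sum_ite_mem, Finset.univ_inter, sum_cosetWeight_mul_re_char hmul]
  -- the prime side
  have hprime : ∑ n ∈ weilPrimeIndex a, c n * ∑ χ : DirichletCharacter ℂ q, w χ * (χ (n : ZMod q)).re =
      (s.card : ℝ) * ((∑ n ∈ (weilPrimeIndex a).filter (fun n : ℕ ↦ ∀ χ ∈ s, χ (n : ZMod q) = 1), c n) +
        (∑ n ∈ (weilPrimeIndex a).filter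
            (fun n : ℕ ↦ ∀ χ ∈ s, χ ((u : ZMod q) * (n : ZMod q)) = 1), c n) / 2 +
        (∑ n ∈ (weilPrimeIndex a).filter
            (fun n : ℕ ↦ ∀ χ ∈ s, χ (((u⁻¹ : (ZMod q)ˣ) : ZMod q) * (n : ZMod q)) = 1), c n) / 2) := by
    simp_rw [hclass]
    have : ∀ n : ℕ, c n * ((s.card : ℝ) * ((if ∀ χ ∈ s, χ (n : ZMod q) = 1 then 1 else 0) +
        (if ∀ χ ∈ s, χ ((u : ZMod q) * (n : ZMod q)) = 1 then 1 / 2 else 0) +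
        (if ∀ χ ∈ s, χ (((u⁻¹ : (ZMod q)ˣ) : ZMod q) * (n : ZMod q)) = 1 then 1 / 2 else 0))) =
        (s.card : ℝ) * ((if ∀ χ ∈ s, χ (n : ZMod q) = 1 then c n else 0) +
          (if ∀ χ ∈ s, χ ((u : ZMod q) * (n : ZMod q)) = 1 then c n else 0) / 2 +
          (if ∀ χ ∈ s, χ (((u⁻¹ : (ZMod q)ˣ) : ZMod q) * (n : ZMod q)) = 1 then c n else 0) / 2) := by
      intro n
      split_ifs <;> ring
    simp_rw [this]
    rw [← Finset.mul_sum, Finset.sum_add_distrib, Finset.sum_add_distrib, ← Finset.sum_div, ← Finset.sum_div,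
      Finset.sum_filter, Finset.sum_filter, Finset.sum_filter]
  -- the constants side: `Σ_χ w χ K χ = Σ_{χ∈s} (1 + Re χ u) K χ`
  have hconst : ∑ χ : DirichletCharacter ℂ q, w χ * K χ = ∑ χ ∈ s, (1 + (χ (u : ZMod q)).re) * K χ := by
    have : ∀ χ : DirichletCharacter ℂ q, w χ * K χ =
        if χ ∈ s then (1 + (χ (u : ZMod q)).re) * K χ else 0 := fun χ ↦ by
      simp only [hw]; split_ifs <;> ring
    simp_rw [this]
    rw [Finset.sum_ite_mem, Finset.univ_inter]
  rw [hsumw, hw1] at hmaster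
  rw [show (fun n ↦ (Λ n : ℝ) / Real.sqrt n * (1 - Real.log n / (2 * a)) *
      ∑ χ : DirichletCharacter ℂ q, w χ * (χ (n : ZMod q)).re) =
      fun n ↦ c n * ∑ χ : DirichletCharacter ℂ q, w χ * (χ (n : ZMod q)).re from rfl,
    hprime] at hmaster
  have hK' : ∑ χ : DirichletCharacter ℂ q, w χ *
      ((Real.log (4 * π) + Real.eulerMascheroniConstant +
          2 * ∫ t in Ioi (0 : ℝ), weilKillingDensityPar (charParity χ) t) -
        1 / a * ∫ t in Ioi (0 : ℝ), weilArchDensityPar (charParity χ) t * min t (2 * a)) =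
      ∑ χ ∈ s, (1 + (χ (u : ZMod q)).re) * K χ := hconst
  rw [hK'] at hmaster
  have e32 : (2 : ℝ) * (16 * Real.sinh (a / 2) ^ 2 / a) = 32 * Real.sinh (a / 2) ^ 2 / a := by ring
  simp only [hK] at hmaster
  linarith [hmaster, e32]

/-- **ONE-SIDED CHEBOTAREV FOR THE CLASS `uH^⊥`, with numbers** (`q ≠ 1`, `a > 0`, `H ∋ 1` multiplicatively
closed, `u ∉ H^⊥`): under the rungs of `ζ` and of every `χ ∈ H ∖ {1}` at the window `a`,

  `Σ_{log n<2a, u⁻¹n ∈ H^⊥} Λ(n) n^{-1/2} (1 − log n/(2a))`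
    `≤ (1 − 2/|H|)·log q + 32 sinh²(a/2)/(|H|·a) − (2.23 − 5/a)`

— the prime powers in the Frobenius class of `u` in `Gal(K_H/ℚ) ≅ (ℤ/q)^×/H^⊥` below `e^{2a}`, bounded at
square-root strength (`x = e^{2a}`: main term `16(√x − 2 + x^{-1/2})/(|H| log x)`) with the GRH-type `log q`,
from positivity at ONE window (Lagarias–Odlyzko's effective Chebotarev theorem gives the two-sided GRH
statement from the zeros). -/
theorem coset_flatSum_le_of_subgroupFamily [NeZero q] (hq : q ≠ 1) (ha : 0 < a)
    {s : Finset (DirichletCharacter ℂ q)} (h1 : (1 : DirichletCharacter ℂ q) ∈ s)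
    (hmul : ∀ χ ∈ s, ∀ ψ ∈ s, χ * ψ ∈ s)
    (hζ : WeilPositivityOn a) (hχ : ∀ χ ∈ s, χ ≠ 1 → WeilPositivityOnChar χ a)
    (u : (ZMod q)ˣ) (hu : ¬ ∀ χ ∈ s, χ (u : ZMod q) = 1) :
    ∑ n ∈ (weilPrimeIndex a).filter
        (fun n : ℕ ↦ ∀ χ ∈ s, χ (((u⁻¹ : (ZMod q)ˣ) : ZMod q) * (n : ZMod q)) = 1),
        (Λ n : ℝ) / Real.sqrt n * (1 - Real.log n / (2 * a)) ≤
      (1 - 2 / s.card) * Real.log q + 32 * Real.sinh (a / 2) ^ 2 / (s.card * a) - (2.23 - 5 / a) := by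
  classical
  have h := coset_flatWindow_le_of_subgroupFamily hq ha h1 hmul hζ hχ u hu
  have hcard : (0 : ℝ) < s.card := by exact_mod_cast Finset.card_pos.2 ⟨1, h1⟩
  -- constants: weights `≥ 0` summing to `|H|`, each `K − I/a ≥ 2.23 − 5/a`
  have hsumw : ∑ χ ∈ s, (1 + (χ (u : ZMod q)).re) = (s.card : ℝ) := by
    rw [Finset.sum_add_distrib, Finset.sum_const, nsmul_eq_mul, mul_one, ← Complex.re_sum,
      re_sum_char_eq_of_mulClosed hmul, if_neg hu, add_zero]
  have hK : (s.card : ℝ) * (2.23 - 5 / a) ≤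
      ∑ χ ∈ s, (1 + (χ (u : ZMod q)).re) *
        ((Real.log (4 * π) + Real.eulerMascheroniConstant +
            2 * ∫ t in Ioi (0 : ℝ), weilKillingDensityPar (charParity χ) t) -
          1 / a * ∫ t in Ioi (0 : ℝ), weilArchDensityPar (charParity χ) t * min t (2 * a)) := by
    rw [← hsumw, Finset.sum_mul]
    refine Finset.sum_le_sum fun χ _ ↦ mul_le_mul_of_nonneg_left ?_ (weight_nonneg χ _)
    have h1' := flatWindow_archConst_ge ha χ
    have h2 : (2.23 : ℝ) ≤ if χ.Even then (5.3716 : ℝ) else 2.23 := by split_ifs <;> norm_num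
    linarith
  have hS1 : 0 ≤ ∑ n ∈ (weilPrimeIndex a).filter (fun n : ℕ ↦ ∀ χ ∈ s, χ (n : ZMod q) = 1),
      (Λ n : ℝ) / Real.sqrt n * (1 - Real.log n / (2 * a)) :=
    Finset.sum_nonneg fun n hn ↦ flatSum_term_nonneg ha (Finset.mem_of_mem_filter n hn)
  have hS2 : 0 ≤ ∑ n ∈ (weilPrimeIndex a).filter
      (fun n : ℕ ↦ ∀ χ ∈ s, χ ((u : ZMod q) * (n : ZMod q)) = 1),
      (Λ n : ℝ) / Real.sqrt n * (1 - Real.log n / (2 * a)) :=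
    Finset.sum_nonneg fun n hn ↦ flatSum_term_nonneg ha (Finset.mem_of_mem_filter n hn)
  set S := ∑ n ∈ (weilPrimeIndex a).filter
      (fun n : ℕ ↦ ∀ χ ∈ s, χ (((u⁻¹ : (ZMod q)ˣ) : ZMod q) * (n : ZMod q)) = 1),
      (Λ n : ℝ) / Real.sqrt n * (1 - Real.log n / (2 * a))
  have hmain : (s.card : ℝ) * S ≤ ((s.card : ℝ) - 2) * Real.log q + 32 * Real.sinh (a / 2) ^ 2 / a -
      (s.card : ℝ) * (2.23 - 5 / a) := by nlinarith
  have : S ≤ (((s.card : ℝ) - 2) * Real.log q + 32 * Real.sinh (a / 2) ^ 2 / a -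
      (s.card : ℝ) * (2.23 - 5 / a)) / s.card := by
    rw [le_div_iff₀ hcard]; linarith
  refine this.trans_eq ?_
  field_simp

end Summit.Ventures.WeilGRH

end
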